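import Summits.BirchSwinnertonDyer.BirchSwinnertonDyer.Theorems.EisensteinPrimesAnomalousLocalLine
import HarnessLib

/-!
# Route `EisensteinPrimes`, crux 2 `GoodLatticeBDPValue` (stmt-BirchSwinnertonDyer-19032), line `halves`, V20 road
# brick (f), part 2: the ANOMALOUS LOCAL PACKAGE for `E[p] ⊂ E[p^∞]` — `#E[p]^H ≤ p`, `E[p]^H = E[p]^D`,
# `E[p^∞]^H` finite or divisible, and the (L)-free local Kummer bound `#ker(H¹(H,E[p]) → H¹(H,E[p^∞])) ≤ p`

Cell `bsd-eis` (home `run/shared/lean/pub/bsd-eis/`), width seat `bsd-line-x1-p1-w2` gen 3 (`--supports -19032`,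
closes nothing). Sequel of `…AnomalousLocalLine` (the `p`-power descent `D ⇝ D ⊓ ker κ` on a line, the fixed part of a
finite stable `T ⊇ Φ`, cocyclicity). Here `E` is an elliptic curve over a number field `K`, `κ` ANY `ℤ_p`-extension,
`D ≤ Γ_K` closed and `H ≤ D` the subgroup `{x ∈ D | κ x = 1}` (the shape `GreenbergSelmer.decompIn (ker κ) v̄` of the
tree's local Selmer conditions and of UTD's `…LocalKummerKernel`), and the only input is ONE `τ ∈ D` mapping a line
`Φ ≤ E[p]` (`#Φ = p`) into itself and moving it — at the good anomalous datum of crux 2, `D = D_v̄` and `τ` an inertia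
element acting non-trivially on the ramified line `𝔽(ω̃)` (Serre 1972 §1.11: inertia acts on the ordinary line through
`χ̄_p`, onto `𝔽_pˣ`). Conclusions (KY arXiv:2402.12781v2 §1.3 in the `K_∞`-currency):

* **`natCard_fixedPoints_geomTorsion_le`**: `#E[p]^H ≤ p` — KY Lemma 1.3.5 «`ker(res_{M_f[𝔭]}) ∈ {0, 𝔽}`», i.e.
  `dim H⁰(K_{∞,v̄}, E[p]) ≤ 1`;
* **`smul_eq_of_mem_fixedPoints_geomTorsion`**: `E[p]^H = E[p]^D` — `E(K_{∞,v̄})[p] = E(K_v̄)[p]`, the group whose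
  (non)vanishing separates KY's Cases I–II from Case III;
* `ncard_fixedPoints_geomPrimaryTorsion_pTorsion_le`, **`fixedPoints_geomPrimaryTorsion_finite_or_divisible`**:
  `B = E[p^∞]^H` has `#B[p] ≤ p`, hence is finite or `p`-divisible — KY Prop. 1.3.3 (ii)–(iii) «cyclic» (finiteness
  itself = the tree's `SchneiderFreeControlAtoms.LocalTowerTorsionFiniteAt`, Fin_v, is NOT claimed here);
* **`natCard_ker_kummer_le`**: `#ker(H¹(H, E[p]) → H¹(H, E[p^∞])) ≤ p` — UTD's exact count
  `natCard_ker_kummer_eq_natCard_quotient` (`= #(B/pB)`) + cocyclicity. This is the (L)-free local input of the E-side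
  Kummer comparison `R(E[p]) ↔ Sel(E[p^∞])[p]` at an ANOMALOUS `v̄`, where the tree's (L) «`E(K_{∞,v̄})[p] = 0`»
  (x2-p2's `…ResidualDevissageCountNonsplit` §1, UTD's `…ResidualSelmerExact`) fails in KY's Cases I–II.

HONEST FRAMING: helper theorems only (0 definitions, 0 named facts, 0 sorry); nothing specific to the crux's curve; no
summit statement, no BSD / IMC2 / KY Thm 1.4.1 (iii) is proved; 0 cells / labels move.
References: [KellerYin2024] §1.3 Prop. 1.3.3, Lemma 1.3.5, §1.4 Cases I–III (arXiv:2402.12781v2 TeX L922–960,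
L1009–1046, L1142–1160); [GreenbergLNM1716] §3 proof of Lemma 3.1, §5 p. 114; [SerreGaloisCohomology1997] I §5.1;
[SilvermanAEC2009] Cor. III.6.4.
-/

set_option autoImplicit false
-- the route's Theorems namespace repeats the summit name by design (D-0017 nested layout)
set_option linter.dupNamespace false

noncomputable section

open scoped Classical

namespace Summit.BirchSwinnertonDyer.BirchSwinnertonDyer.Theorems.AnomalousLocalTorsion

open NumberField IsDedekindDomain Field WeierstrassCurve
  Literature.NumberTheory.EllipticCurves Literature.NumberTheory.EllipticCurves.GreenbergSelmer
  Literature.NumberTheory.GaloisRepresentations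
  Summit.BirchSwinnertonDyer.Rank1Residual.X11b

variable {K : Type} [Field K] [NumberField K] {p : ℕ} [hp : Fact p.Prime] (κ : ZpExtension K p)

/-! ## §4. Elliptic curves: `#E[p]^H ≤ p`, `E[p]^H = E[p]^D`, and the (L)-free local Kummer bound -/

section Elliptic

variable (E : WeierstrassCurve K) [E.IsElliptic] {D : Subgroup (absoluteGaloisGroup K)} (H : Subgroup D)

omit [NumberField K] hp [E.IsElliptic] in
/-- The coercions: `h ∈ H ≤ D` acts on `E[p]` through `Γ_K`. [folklore] -/
theorem coe_subgroup_smul_geomTorsion (h : H) (x : geomTorsion E (p : ℤ)) :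
    ((h • x : geomTorsion E (p : ℤ)) : geomPoints E) = ((h : D) : absoluteGaloisGroup K) • (x : geomPoints E) :=
  rfl

/-- `#E[p] = p²` and `E[p]` is finite. [cite: SilvermanAEC2009, Cor. III.6.4] -/
theorem natCard_geomTorsion_eq_sq : Nat.card (geomTorsion E (p : ℤ)) = p ^ 2 :=
  card_torsionPoints_eq_sq_holds E (AlgebraicClosure K) (n := p)
    (Nat.cast_ne_zero.mpr hp.out.ne_zero)

variable {E H}

/-- **`#E[p]^H ≤ p`** for `H = D ⊓ ker κ` read inside a closed `D ≤ Γ_K` (`x ∈ H ↔ κ x = 1`), as soon as some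
`τ ∈ D` maps a line `Φ ≤ E[p]` into itself and moves it: the fixed points meet `Φ` trivially and embed in `E[p]/Φ`.
KY Lemma 1.3.5 («`ker(res_{M_f[𝔭]}) ∈ {0, 𝔽}`»: `dim H⁰(K_{∞,v̄}, E[p]) ≤ 1`) in the `K_∞`-currency.
[cite: KellerYin2024, §1.3 Lemma 1.3.5 (arXiv:2402.12781v2 TeX L1009–1013, L1040–1046)] -/
theorem natCard_fixedPoints_geomTorsion_le (hD : IsClosed (D : Set (absoluteGaloisGroup K)))
    (hH : ∀ x : D, x ∈ H ↔ (x : absoluteGaloisGroup K) ∈ κ.kerSubgroup)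
    (Φ : AddSubgroup (geomPoints E)) (hΦle : Φ ≤ geomTorsion E (p : ℤ)) (hΦ : Nat.card Φ = p)
    {τ : absoluteGaloisGroup K} (hτD : τ ∈ D) (hτΦ : ∀ P ∈ Φ, τ • P ∈ Φ) (hmove : ∃ P ∈ Φ, τ • P ≠ P) :
    Nat.card (FixedPoints.addSubgroup H (geomTorsion E (p : ℤ))) ≤ p := by
  have hpr : p.Prime := hp.out
  set T : AddSubgroup (geomPoints E) := geomTorsion E (p : ℤ) with hTdef
  have hT : Nat.card T = p ^ 2 := natCard_geomTorsion_eq_sq E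
  haveI : Finite T := Nat.finite_of_card_ne_zero (by rw [hT]; exact pow_ne_zero _ hpr.ne_zero)
  set Fx := FixedPoints.addSubgroup H (geomTorsion E (p : ℤ)) with hFx
  set F : AddSubgroup (geomPoints E) := Fx.map T.subtype with hFdef
  have hFT : F ≤ T := by
    rintro m ⟨x, -, rfl⟩
    exact x.2
  have hFfix : ∀ m ∈ F, ∀ g ∈ D ⊓ κ.kerSubgroup, g • m = m := by
    rintro m ⟨x, hx, rfl⟩ g hg
    obtain ⟨hgD, hgk⟩ := Subgroup.mem_inf.mp hg
    have h := (FixedPoints.mem_addSubgroup _ _ _).mp hx ⟨⟨g, hgD⟩, (hH _).mpr hgk⟩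
    exact congrArg Subtype.val h
  have hcardF : Nat.card F = Nat.card Fx := by
    rw [hFdef]
    exact Nat.card_congr (Fx.equivMapOfInjective T.subtype T.subtype_injective).toEquiv.symm
  have hle := natCard_mul_le_of_fixed κ D hD (continuous_smul_geomPoints E) Φ T F hΦle hFT hΦ hτD hτΦ hmove
    hFfix
  rw [hT, pow_two, hcardF] at hle
  exact Nat.le_of_mul_le_mul_right hle hpr.pos

/-- **`E[p]^H = E[p]^D`** (`H = D ⊓ ker κ` inside a closed `D`): a point of `E[p]` fixed by the local tower group is
fixed by the whole decomposition group, as soon as some `τ ∈ D` stabilising a line `Φ ≤ E[p]` moves it. At the good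
anomalous `v̄`: `E(K_{∞,v̄})[p] = E(K_v̄)[p]`, the group whose (non)vanishing separates KY's Cases I–II from III.
[cite: KellerYin2024, §1.4 Cases I–III (arXiv:2402.12781v2 TeX L1142–1147)] -/
theorem smul_eq_of_mem_fixedPoints_geomTorsion (hD : IsClosed (D : Set (absoluteGaloisGroup K)))
    (hH : ∀ x : D, x ∈ H ↔ (x : absoluteGaloisGroup K) ∈ κ.kerSubgroup)
    (Φ : AddSubgroup (geomPoints E)) (hΦle : Φ ≤ geomTorsion E (p : ℤ)) (hΦ : Nat.card Φ = p)
    {τ : absoluteGaloisGroup K} (hτD : τ ∈ D) (hτΦ : ∀ P ∈ Φ, τ • P ∈ Φ) (hmove : ∃ P ∈ Φ, τ • P ≠ P)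
    {x : geomTorsion E (p : ℤ)} (hx : x ∈ FixedPoints.addSubgroup H (geomTorsion E (p : ℤ)))
    {d : absoluteGaloisGroup K} (hd : d ∈ D) : d • x = x := by
  have hfix : ∀ g ∈ D ⊓ κ.kerSubgroup, g • (x : geomPoints E) = x := by
    intro g hg
    obtain ⟨hgD, hgk⟩ := Subgroup.mem_inf.mp hg
    have h := (FixedPoints.mem_addSubgroup _ _ _).mp hx ⟨⟨g, hgD⟩, (hH _).mpr hgk⟩
    exact congrArg Subtype.val h
  apply Subtype.ext
  rw [AddSubgroup.torsionBy.coe_smul]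
  exact smul_eq_of_fixed_of_natCard_eq_sq κ D hD (continuous_smul_geomPoints E) Φ (geomTorsion E (p : ℤ)) hΦle hΦ
    (natCard_geomTorsion_eq_sq E) (fun d hd m hm ↦ smul_mem_torsionBy d hm) hτD hτΦ hmove x.2 hfix d hd

/-- **The local tower torsion `B = E[p^∞]^H` has `#{b ∈ B | p b = 0} ≤ p`** (its `p`-torsion is `E[p]^H`).
[cite: KellerYin2024, §1.3 Prop. 1.3.3 (ii)–(iii) (arXiv:2402.12781v2 TeX L922–931)] -/
theorem ncard_fixedPoints_geomPrimaryTorsion_pTorsion_le (hD : IsClosed (D : Set (absoluteGaloisGroup K)))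
    (hH : ∀ x : D, x ∈ H ↔ (x : absoluteGaloisGroup K) ∈ κ.kerSubgroup)
    (Φ : AddSubgroup (geomPoints E)) (hΦle : Φ ≤ geomTorsion E (p : ℤ)) (hΦ : Nat.card Φ = p)
    {τ : absoluteGaloisGroup K} (hτD : τ ∈ D) (hτΦ : ∀ P ∈ Φ, τ • P ∈ Φ) (hmove : ∃ P ∈ Φ, τ • P ≠ P) :
    Set.ncard {c : E.geomPrimaryTorsion p |
      c ∈ FixedPoints.addSubgroup H (E.geomPrimaryTorsion p) ∧ p • c = 0} ≤ p := by
  have hpr : p.Prime := hp.out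
  haveI : Finite (geomTorsion E (p : ℤ)) :=
    Nat.finite_of_card_ne_zero (by rw [natCard_geomTorsion_eq_sq E]; exact pow_ne_zero _ hpr.ne_zero)
  rw [← Nat.card_coe_set_eq]
  refine le_trans (Nat.card_le_card_of_injective (fun c ↦ (⟨⟨((c : E.geomPrimaryTorsion p) : geomPoints E),
    AddSubgroup.torsionBy.nsmul_iff.mpr ?_⟩, fun σ ↦ ?_⟩ : FixedPoints.addSubgroup H (geomTorsion E (p : ℤ))))
    ?_) (natCard_fixedPoints_geomTorsion_le κ hD hH Φ hΦle hΦ hτD hτΦ hmove)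
  · have h := congrArg (fun z : E.geomPrimaryTorsion p ↦ (z : geomPoints E)) c.2.2
    simpa only [AddSubmonoidClass.coe_nsmul, ZeroMemClass.coe_zero] using h
  · apply Subtype.ext
    rw [coe_subgroup_smul_geomTorsion]
    have h := (FixedPoints.mem_addSubgroup _ _ _).mp c.2.1 σ
    exact congrArg (fun z : E.geomPrimaryTorsion p ↦ (z : geomPoints E)) h
  · intro a b hab
    apply Subtype.ext; apply Subtype.ext
    exact congrArg (fun z : FixedPoints.addSubgroup H (geomTorsion E (p : ℤ)) ↦
      ((z : geomTorsion E (p : ℤ)) : geomPoints E)) hab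

/-- **The local tower torsion is FINITE OR DIVISIBLE**: `B = E[p^∞]^H` (`H = D ⊓ ker κ` in a closed `D`) is finite
or `p`-divisible when some `τ ∈ D` stabilising a line `Φ ≤ E[p]` moves it — KY Prop. 1.3.3 (ii)–(iii)'s «cyclic»
(`𝒪/𝔭^b` or `F/𝒪`) at an anomalous `v̄`; finiteness itself (Fin_v) is NOT claimed here.
[cite: KellerYin2024, §1.3 Prop. 1.3.3 (ii)–(iii) (arXiv:2402.12781v2 TeX L922–960)] -/
theorem fixedPoints_geomPrimaryTorsion_finite_or_divisible (hD : IsClosed (D : Set (absoluteGaloisGroup K)))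
    (hH : ∀ x : D, x ∈ H ↔ (x : absoluteGaloisGroup K) ∈ κ.kerSubgroup)
    (Φ : AddSubgroup (geomPoints E)) (hΦle : Φ ≤ geomTorsion E (p : ℤ)) (hΦ : Nat.card Φ = p)
    {τ : absoluteGaloisGroup K} (hτD : τ ∈ D) (hτΦ : ∀ P ∈ Φ, τ • P ∈ Φ) (hmove : ∃ P ∈ Φ, τ • P ≠ P) :
    (FixedPoints.addSubgroup H (E.geomPrimaryTorsion p) : Set (E.geomPrimaryTorsion p)).Finite ∨
      ∀ x ∈ FixedPoints.addSubgroup H (E.geomPrimaryTorsion p),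
        ∃ y ∈ FixedPoints.addSubgroup H (E.geomPrimaryTorsion p), p • y = x := by
  have htor : ∀ x : E.geomPrimaryTorsion p, ∃ k : ℕ, p ^ k • x = 0 := fun x ↦ by
    obtain ⟨k, hk⟩ := x.2
    exact ⟨k, Subtype.ext (by rw [AddSubmonoidClass.coe_nsmul, hk]; rfl)⟩
  exact finite_or_forall_exists_nsmul_eq htor (AcSelmer.finite_setOf_geomPrimaryTorsion_pow_smul_eq_zero E hp.out.ne_zero)
    _ (ncard_fixedPoints_geomPrimaryTorsion_pTorsion_le κ hD hH Φ hΦle hΦ hτD hτΦ hmove)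

/-- **The (L)-free LOCAL KUMMER BOUND: `#ker(H¹(H, E[p]) → H¹(H, E[p^∞])) ≤ p`** for `H = D ⊓ ker κ` read inside a
closed `D ≤ Γ_K`, as soon as some `τ ∈ D` stabilising a line `Φ ≤ E[p]` moves it. The kernel has order
`#(B/pB)`, `B = E[p^∞]^H` (UTD's `natCard_ker_kummer_eq_natCard_quotient`), and `B` is finite with `#B/pB = #B[p] ≤ p`
or divisible with `B/pB = 0` (§3). This is what replaces hypothesis (L) «`E(K_{∞,v̄})[p] = 0`» of the tree's residual
counts at an ANOMALOUS `v̄` (KY Cases I–II, where (L) fails). [cite: KellerYin2024, §1.3 Lemma 1.3.5 and §1.4 Cases I–III (arXiv:2402.12781v2 TeX L1009–1046, L1142–1160)]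
[cite: GreenbergLNM1716, §3 proof of Lemma 3.1] -/
theorem natCard_ker_kummer_le (hD : IsClosed (D : Set (absoluteGaloisGroup K)))
    (hH : ∀ x : D, x ∈ H ↔ (x : absoluteGaloisGroup K) ∈ κ.kerSubgroup)
    (Φ : AddSubgroup (geomPoints E)) (hΦle : Φ ≤ geomTorsion E (p : ℤ)) (hΦ : Nat.card Φ = p)
    {τ : absoluteGaloisGroup K} (hτD : τ ∈ D) (hτΦ : ∀ P ∈ Φ, τ • P ∈ Φ) (hmove : ∃ P ∈ Φ, τ • P ≠ P) :
    Nat.card ((resH1Hom (ContinuousMonoidHom.id H)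
        (AddSubgroup.inclusion (geomTorsion_le_geomPrimaryTorsion E p)) (fun _ _ ↦ rfl) :
          subgroupH1 H (geomTorsion E (p : ℤ)) →+ subgroupH1 H (E.geomPrimaryTorsion p)).ker) ≤ p := by
  rw [UniversalToricDescentLocalKummer.natCard_ker_kummer_eq_natCard_quotient]
  have htor : ∀ x : E.geomPrimaryTorsion p, ∃ k : ℕ, p ^ k • x = 0 := fun x ↦ by
    obtain ⟨k, hk⟩ := x.2
    exact ⟨k, Subtype.ext (by rw [AddSubmonoidClass.coe_nsmul, hk]; rfl)⟩
  exact natCard_quotient_nsmul_le htor (AcSelmer.finite_setOf_geomPrimaryTorsion_pow_smul_eq_zero E hp.out.ne_zero) _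
    (ncard_fixedPoints_geomPrimaryTorsion_pTorsion_le κ hD hH Φ hΦle hΦ hτD hτΦ hmove)

end Elliptic


end Summit.BirchSwinnertonDyer.BirchSwinnertonDyer.Theorems.AnomalousLocalTorsion
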